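import Summits.HodgeConjecture.HodgeConjecture.Theorems.H413SpectrumInterfaces
import Summits.HodgeConjecture.HodgeConjecture.Theorems.HCCMUnconditionalH413OfFacts
import Summits.HodgeConjecture.HodgeConjecture.Theorems.HCCMUnconditionalH411
import Literature.NumberTheory.Automorphic.Liu2021.Prop413OccurrenceTransport
import HarnessLib

/-!
# FLOOR-0 P2∕P4 spectrum interfaces — KERNEL HALF: the theorems over `Theorems/H413SpectrumInterfaces.lean` (defs-only half)

Split of F0P2-plan (g0)'s boxed single file 2a65bff7073aefd5 (courier A-p18 (g15), GO 2026-08-30T21:57:48Z): the 13 theorems + heads — `Iff.rfl` letter-fidelity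
witnesses, the generic KERNEL composition (`occursIn_of_realisedIn`, `heckeLevelRigidity_of_omegaIrreducibleOrZero`, `dictionaryExistence_of_parts`, `spectrumIsThetaAtLevel_of_parts`),
the `cotPart` lattice lemmas, Def. 4.11 by name (`omegaIrreducibleOrZero_datum413` ⟸ ★ `H411_proof`), and the hypotheses-explicit heads (`stubU2_of`,
`oscillatorTriple_dictionaryExistence_holds_of(_split)`, `H413_of_split`).  Same namespace `…Cruxes.H413.SpectrumInterfaces`; decl texts unchanged; zero `sorry`.
HC_CM is proved only modulo the 7 printed citations until rung 0 closes.
-/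

set_option autoImplicit false

-- the mandated namespace has the single-problem summit's repeated segment (`HodgeConjecture.HodgeConjecture`), as in every `Cruxes/…/Lines/*.lean` of this sub-problem
set_option linter.dupNamespace false

noncomputable section

namespace Summit.HodgeConjecture.HodgeConjecture.Cruxes.H413.SpectrumInterfaces


open scoped TensorProduct Matrix
open NumberField NumberField.InfinitePlace IsDedekindDomain
open HodgeCM.Model HodgeCM.Model.LiuIndex HodgeCM.Model.TowerCarrier
open Summit.HodgeConjecture.CorCM.Model
open Literature.AlgebraicGeometry.Motives (CMType AbelianVariety)
open Literature.AlgebraicGeometry.HodgeTheory Literature.NumberTheory.Automorphic.PicardCM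
open Literature.AlgebraicGeometry.ShimuraVarieties Literature.AlgebraicGeometry.ShimuraVarieties.UnitaryCanonicalModel
open Literature.NumberTheory.ComplexMultiplication
open Literature.NumberTheory.Automorphic
open Literature.NumberTheory.Automorphic.Liu2021 Literature.NumberTheory.Automorphic.Liu2021.AppendixC
open Literature.NumberTheory.Automorphic.Liu2021.Def411WeilCarriers (lineOf locF Rep)
open Summit.HodgeConjecture.CorCM.Transposition.OmegaTransport (realUnit)
open HodgeCM.Model.ArchSideTerm (e₁)
open Literature.NumberTheory.GelbartRogawski1991 Literature.NumberTheory.GelbartRogawski1991.UnitaryDualPair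
open Literature.RepresentationTheory Literature.RepresentationTheory.Liu2021
open Summit.HodgeConjecture.CorCM
open Summit.HodgeConjecture.CorCM.Transposition
open Literature.NumberTheory.GelbartRogawski1991.OscillatorTripleDictionary (OccursInH1 IsIsoToOmega rhoTriple)
open Summit.HodgeConjecture.CorCM.Lines.A3Liu418 (Thm415AtFace EpsRigidAtFace)
open Summit.HodgeConjecture.HodgeConjecture.Theses (HCCMUnconditional.HDel)
open MulAction
open Literature.Geometry.ComplexHyperbolic.BallModel (U21 x₀)
open Summit.HodgeConjecture.CorCM.Lines.A3Liu413 (datum413)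
open Summit.HodgeConjecture.HodgeConjecture.Cruxes.H413.CohFormsCarriers

/-! ## §0  The three binder types of the floor, VERBATIM (floor V7 ll. 72–85) — pasted token-identically from the line of record v3 §0 (A-p18 (g15)) -/

set_option synthInstance.maxHeartbeats 400000 in
set_option maxHeartbeats 8000000 in
/-- `HdictEType` IS `∀ face, oscillatorTriple_dictionaryExistence (datum413 …)` — `datum413` (A3Liu413FaceTypes :179) abbreviates the binder's own term (`Iff.rfl`;
letter-fidelity witness for the desk). [cite: Liu2021, Prop. 4.13] -/
theorem hdictEType_iff_datum413 :
    HdictEType ↔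
      ∀ (hDel : Literature.AlgebraicGeometry.ShimuraVarieties.UnitaryCanonicalModel.canonicalModel_exists_printed)
        (F : HodgeCM.CMField) [IsGalois ℚ F] (h6 : 6 ≤ Module.finrank ℚ F) {ι₁ : F →+* ℂ} (V : HodgeCM.HermSpace3 F ι₁) (a₀ : RealScalar F)
        (Φ : CMType F) (hΦ : ι₁ ∈ Φ.1) (i : (I V (repAt a₀) (muLiu ι₁ GramClass.rep))),
      oscillatorTriple_dictionaryExistence (datum413 hDel F V a₀ Φ i) :=
  Iff.rfl

/-! ## §1  The middle object = programme P4's carriers ★ p787557 `Theorems/H413CohFormsCarriers.lean` (A-p13 (g21); namespace `…Cruxes.H413.CohFormsCarriers`, opened above):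
`adelicDatum F V` (= `UnitaryGroup.adelicGroupData (K F) 3 (Hm V) …`), `finToAdelic`, `ArchFactor` (+ `IsHonest`), `rightRep F V`, `smoothFun`, `conjFun`, `holCotForms`, `cohForms`,
THE FACTOR OF RECORD `archFactorOf F V` — shared with programmes P4 and P2 BY NAME. -/

/-! ## §2  Generic shapes over a [Liu2021, Prop. 4.13] datum `P` — PASTED TOKEN-IDENTICALLY from the line of record v3 §2 (A-p18 (g15)); new in this file: `OccursInSomePart`,
`spectrumIsThetaAtLevel_of_parts` (end of the section) -/

section Generic

variable {F₀ E₀ : Type} [Field F₀] [NumberField F₀] [IsTotallyReal F₀] [Field E₀] [NumberField E₀] [Algebra F₀ E₀]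
  [IsTotallyComplex E₀] [Algebra.IsQuadraticExtension F₀ E₀]

/-- An admissible `ε` is global (drop the sign clause of Def. 4.12). [cite: Liu2021, Def. 4.12 (l. 2102–2108)] -/
theorem isGlobalEps_of_isAdmissible (P : Prop413Data F₀ E₀) (t : P.Triple) (h : t.IsAdmissible) : IsGlobalEps P t.ε := by
  obtain ⟨e, he, hε⟩ := h
  exact ⟨e, he.1, he.2.1, hε⟩

/-- **HECKE-LEVEL RIGIDITY IS A THEOREM** (v1's stub U3, closed): given Def. 4.11's «irreducible or zero» for the `ω_t`, a Hecke-related pair `(σ, ω_t)` at a compact open level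
with `σ` irreducible is isomorphic — the Hecke-related map is non-zero on `σ^K` with values in `ω_t^K`, so `ω_t ≠ 0` is irreducible (★ `isIrreducible_of_nontrivial`), compact
open `K` is a Hecke pair (★ `isHeckeTriple_top_of_isCompact_isOpen`, `finite_orbit_quotient`), and ★ `nonempty_equiv_of_heckeEquivariant` ([BushnellHenniart2006, §4.3]) gives
the equivariant isomorphism. [cite: BushnellHenniart2006, §4.3 Proposition] [cite: Bump1997, Prop. 4.2.3] [cite: Liu2021, Def. 4.11] -/
theorem heckeLevelRigidity_of_omegaIrreducibleOrZero (P : Prop413Data F₀ E₀) (hω : OmegaIrreducibleOrZero P) :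
    HeckeLevelRigidity P := by
  intro W _ _ σ hσ t hw _hglob K hKo hKc hrel
  obtain ⟨φ, hφK, hφT, v, hv, hv0⟩ := hrel
  haveI : σ.IsIrreducible := hσ
  haveI : Nontrivial (P.omega t.μ t.isConjugateSymplectic t.ε t.χ) := nontrivial_of_ne (φ v) 0 hv0
  haveI : (rhoTriple P t).IsIrreducible := isIrreducible_of_nontrivial (hω t hw)
  haveI : IsHeckeTriple (⊤ : Submonoid P.G) K K := isHeckeTriple_top_of_isCompact_isOpen K hKc hKo
  have hfin : ∀ g : P.G, (orbit K (g : P.G ⧸ K)).Finite := fun g => finite_orbit_quotient K g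
  obtain ⟨e⟩ := nonempty_equiv_of_heckeEquivariant σ (rhoTriple P t) K hfin φ hφK hφT ⟨v, hv, hv0⟩
  exact ⟨e.toLinearEquiv, fun g w => Representation.IntertwiningMap.isIntertwining _ _ e.toIntertwiningMap g w⟩

/-- **Transfer of occurrence from `H¹_{B,τ'}` to the function space** along an injective equivariant realisation: injective ∘ (non-zero intertwiner) is a non-zero equivariant map.
[cite: Liu2021, proof of Prop. 4.13, l. 2131] -/
theorem occursIn_of_realisedIn (P : Prop413Data F₀ E₀) (τ' : E₀ →+* ℂ) {X : Type} [AddCommGroup X] [Module ℂ X]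
    (R : Representation ℂ P.G X) (A : Submodule ℂ X) (hR : RealisedIn P τ' R A)
    {W : Type} [AddCommGroup W] [Module ℂ W] (σ : Representation ℂ P.G W) (hocc : OccursInH1 P τ' σ) :
    OccursIn P R A σ := by
  obtain ⟨r, hrinj, hrA, hreq⟩ := hR
  obtain ⟨j, hj⟩ := hocc
  refine ⟨r ∘ₗ j.toLinearMap, ?_, fun w => hrA _, fun g w => ?_⟩
  · intro h0
    apply hj
    apply Representation.IntertwiningMap.ext
    apply LinearMap.ext
    intro w
    have h1 : r (j w) = 0 := by
      have := congrArg (fun φ : W →ₗ[ℂ] X => φ w) h0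
      simpa using this
    have h2 : j w = 0 := hrinj (by rw [h1, map_zero])
    simpa using h2
  · simp only [LinearMap.coe_comp, Function.comp_apply, Representation.IntertwiningMap.coe_toLinearMap]
    rw [Representation.IntertwiningMap.isIntertwining σ (P.rhoB τ') j g w, hreq]

/-- **THE COMPOSITION (kernel, no `sorry`)**: U1 (realisation) + U2 (spectrum of `A` is theta) + Def. 4.11's «irreducible or zero» (⇒ Hecke-level rigidity) + U4 (sign rule) ⟹ the
EXISTENCE half of the oscillator-triple dictionary for `P`.  `σ ↪ H¹` occurs in `A` by U1 (`occursIn_of_realisedIn`); U2 gives a level `K` and a genuine weight-one triple `t` with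
`σ`, `ω_t` Hecke-related; rigidity gives `σ ≅ ω_t`; occurrence moves along the isomorphism (★ `Prop413Data.occursInH1_of_equiv`); U4 makes `ε` admissible; the admissible weight-one
triple `⟨t, hw, hadm⟩` with the isomorphism is the witness. [cite: Liu2021, proof of Prop. 4.13, l. 2131–2145; Rem. 4.14]
[cite: GelbartRogawski1991, Introduction p. 448 L30–33; Thm 5.1.1 p. 465] -/
theorem dictionaryExistence_of_parts (P : Prop413Data F₀ E₀) {X : Type} [AddCommGroup X] [Module ℂ X]
    (R : Representation ℂ P.G X) (A : Submodule ℂ X)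
    (h1 : P.n = 3 → ∀ τ' : E₀ →+* ℂ, RealisedIn P τ' R A) (h2 : SpectrumIsThetaAtLevel P R A) (h3 : OmegaIrreducibleOrZero P)
    (h4 : OccurringGlobalThetaIsAdmissible P) : oscillatorTriple_dictionaryExistence P := by
  intro hn τ' W _ _ σ hirr hocc
  obtain ⟨K, hKo, hKc, t, hw, hglob, hrel⟩ := h2 hn W σ hirr (occursIn_of_realisedIn P τ' R A (h1 hn τ') σ hocc)
  obtain ⟨f, hf⟩ := heckeLevelRigidity_of_omegaIrreducibleOrZero P h3 W σ hirr t hw hglob K hKo hKc hrel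
  exact ⟨⟨t, hw, h4 hn τ' t hw hglob (Prop413Data.occursInH1_of_equiv f hf hocc)⟩, f, hf⟩

/-- **KERNEL OF THE CUT (generic)**: if every irreducible occurring in `A` occurs in some part, and the spectrum of every part is theta at finite level, then the spectrum of `A` is
theta at finite level.  Two lines of logic; the content is in the two hypotheses. [cite: Liu2021, Rem. 4.14] [cite: GelbartRogawski1991, Introduction p. 448 L30–33] -/
theorem spectrumIsThetaAtLevel_of_parts (P : Prop413Data F₀ E₀) {X : Type} [AddCommGroup X] [Module ℂ X] (R : Representation ℂ P.G X)
    (A : Submodule ℂ X) {ι : Type} (part : ι → Submodule ℂ X) (hproj : OccursInSomePart P R A part)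
    (hparts : ∀ i : ι, SpectrumIsThetaAtLevel P R (part i)) : SpectrumIsThetaAtLevel P R A := by
  intro hn W _ _ σ hirr hocc
  obtain ⟨i, hi⟩ := hproj hn W σ hirr hocc
  exact hparts i hn W σ hirr hi

end Generic

/-! ## §2b  The `L²` junction at the carriers (NEW): realisations of cotangent forms in `L²(U(V)(F⁺)\U(V)(𝔸_{F⁺}), μ)` and the cotangent ∕ holomorphic ∕ antiholomorphic PART of a
discrete automorphic representation `Π` (★ `AutomorphicSpectrum.lean`: `AdelicGroupData.L2`, `rightRegular`, `DiscreteAutomorphicRep`; ★ `AdelicGroupData.IsAutomorphicMeasure`) -/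

section L2Junction

variable (F : HodgeCM.CMField) {ι₁ : F →+* ℂ} (V : HodgeCM.HermSpace3 F ι₁)

/-- The cotangent part of `Π` sits inside `cohForms 𝔞` (by definition, an `⊓`). [cite: GelfandGraevPiatetskiShapiro1969, Ch. 1 §2] -/
theorem cotPart_le_cohForms (𝔞 : ArchFactor F V) (μ : MeasureTheory.Measure (adelicDatum F V).automorphicQuotient) [(adelicDatum F V).IsAutomorphicMeasure μ]
    (ℓ : ((adelicDatum F V).Adelic → (Fin 2 → ℂ)) →ₗ[ℂ] (Fin 2 → (adelicDatum F V).L2 μ)) (π : DiscreteAutomorphicRep (adelicDatum F V) μ) :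
    cotPart F V 𝔞 μ ℓ π ≤ cohForms 𝔞 := by
  unfold cotPart; exact inf_le_left

/-- The holomorphic part of `Π` sits inside its cotangent part. [cite: GelfandGraevPiatetskiShapiro1969, Ch. 1 §2] -/
theorem holPart_le_cotPart (𝔞 : ArchFactor F V) (μ : MeasureTheory.Measure (adelicDatum F V).automorphicQuotient) [(adelicDatum F V).IsAutomorphicMeasure μ]
    (ℓ : ((adelicDatum F V).Adelic → (Fin 2 → ℂ)) →ₗ[ℂ] (Fin 2 → (adelicDatum F V).L2 μ)) (π : DiscreteAutomorphicRep (adelicDatum F V) μ) :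
    holPart F V 𝔞 μ ℓ π ≤ cotPart F V 𝔞 μ ℓ π := by
  unfold holPart cotPart cohForms; exact inf_le_inf_right _ le_sup_left

/-- The anti-holomorphic part of `Π` sits inside its cotangent part. [cite: GelfandGraevPiatetskiShapiro1969, Ch. 1 §2] -/
theorem antiholPart_le_cotPart (𝔞 : ArchFactor F V) (μ : MeasureTheory.Measure (adelicDatum F V).automorphicQuotient) [(adelicDatum F V).IsAutomorphicMeasure μ]
    (ℓ : ((adelicDatum F V).Adelic → (Fin 2 → ℂ)) →ₗ[ℂ] (Fin 2 → (adelicDatum F V).L2 μ)) (π : DiscreteAutomorphicRep (adelicDatum F V) μ) :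
    antiholPart F V 𝔞 μ ℓ π ≤ cotPart F V 𝔞 μ ℓ π := by
  unfold antiholPart cotPart cohForms; exact inf_le_inf_right _ le_sup_right

/-- membership in the cotangent part, unfolded: `f ∈ cohForms 𝔞` and every coordinate class `ℓ f k` lies in `Π.space`. -/
theorem mem_cotPart_iff (𝔞 : ArchFactor F V) (μ : MeasureTheory.Measure (adelicDatum F V).automorphicQuotient) [(adelicDatum F V).IsAutomorphicMeasure μ]
    (ℓ : ((adelicDatum F V).Adelic → (Fin 2 → ℂ)) →ₗ[ℂ] (Fin 2 → (adelicDatum F V).L2 μ)) (π : DiscreteAutomorphicRep (adelicDatum F V) μ)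
    (f : (adelicDatum F V).Adelic → (Fin 2 → ℂ)) :
    f ∈ cotPart F V 𝔞 μ ℓ π ↔ f ∈ cohForms 𝔞 ∧ ∀ k : Fin 2, ℓ f k ∈ π.space.toSubmodule := by
  simp only [cotPart, Submodule.mem_inf, Submodule.mem_iInf, Submodule.mem_comap, LinearMap.coe_comp, Function.comp_apply,
    LinearMap.proj_apply]

end L2Junction

/-! ## §3  Stub TYPES at the printed datum of every face (`P = datum413 hDel F V a₀ Φ i`, `R = rightRep F V`, `A = cohForms (archFactorOf F V)`).  U1′, the PARENT type U2′, the closed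
Def. 4.11 link and U4 are PASTED TOKEN-IDENTICALLY from the line of record v3 §3 (A-p18 (g15)); U2ℓ, U2a, E2E2b (§3b) are new. -/

set_option synthInstance.maxHeartbeats 400000 in
set_option maxHeartbeats 8000000 in
/-- **(v1's stub U3 — NOW A THEOREM.)  [Liu2021, Def. 4.11] «irreducible (or zero)» for the pin's `ω_V(t)` at every weight-one triple: the route item `H411` BY NAME** — ★
`Theorems.H411_proof` = `Def411AsPrinted` for the δ′-rest `restOfCharDeltaPrime … (ιVE V) (Rep.update … (realUnit a)) μ hμ hw` at every real scalar `a`, read at `a := repAt a₀ i.1`,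
whose `rho ε χ` IS `(datum413 …).rho μ hμ ε χ` (★ `Model.restOfCharRep_eq_rest`, `rfl`); first conjunct = `IsIrreducibleOrZero`.  With `heckeLevelRigidity_of_omegaIrreducibleOrZero`
(★ `HeckeFixedVectorsLift`, [BushnellHenniart2006, §4.3]) this discharges v1's Hecke-level rigidity stub. [cite: Liu2021, Def. 4.11 (l. 2092–2096)] [cite: BushnellHenniart2006, §4.3] -/
theorem omegaIrreducibleOrZero_datum413 :
      ∀ (hDel : Literature.AlgebraicGeometry.ShimuraVarieties.UnitaryCanonicalModel.canonicalModel_exists_printed)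
        (F : HodgeCM.CMField) [IsGalois ℚ F] (h6 : 6 ≤ Module.finrank ℚ F) {ι₁ : F →+* ℂ} (V : HodgeCM.HermSpace3 F ι₁) (a₀ : RealScalar F)
        (Φ : CMType F) (hΦ : ι₁ ∈ Φ.1) (i : (I V (repAt a₀) (muLiu ι₁ GramClass.rep))),
      OmegaIrreducibleOrZero (datum413 hDel F V a₀ Φ i) :=
  fun hDel F _ h6 _ V a₀ Φ hΦ i t hw =>
    (Summit.HodgeConjecture.HodgeConjecture.Theorems.H411_proof hDel F h6 V (repAt a₀ (Sigma.fst i)) Φ hΦ t.μ t.isConjugateSymplectic hw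
      t.ε t.χ).1

/-! ## §3b  The three NEW stub types of the cut (U2ℓ, U2a, E2E2b) -/

/-! ## §3d  The P4 theta-road letter type — VERBATIM from F0P4-plan (g0) `F0/P4/line-F0-P4AdmissibleOccursInH1.lean` 98373f7d760ea57a (T3a; consumed by P4 only) -/

/-! ## §4  The heads as hypotheses-explicit theorems (kernel-checked, no `sorry` in this module) -/

set_option synthInstance.maxHeartbeats 400000 in
set_option maxHeartbeats 8000000 in
/-- **HEAD 0 — THE CUT: the parent stub U2′ of the line of record from U2ℓ, U2a, E2E2b** (`StubU2CohFormsSpectrumIsThetaAt` token-identical to v3; the term A-p18's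
`stub_U2_cohFormsSpectrumIsThetaAt` can be folded to): obtain `(μ, ℓ)` from U2ℓ and apply `spectrumIsThetaAtLevel_of_parts` to U2a and E2E2b at the face.
[cite: Liu2021, Rem. 4.14] [cite: GelbartRogawski1991, Introduction p. 448 L30–33] [cite: Rogawski1990, Thm. 13.3.6] -/
theorem stubU2_of (hl : StubU2lL2Realisation) (ha : StubU2aSpectralProjection) (he : StubE2E2bCotPartSpectrumIsTheta) : StubU2CohFormsSpectrumIsThetaAt := by
  intro hDel F _ h6 ι₁ V a₀ Φ hΦ i
  obtain ⟨μ, hμ, ℓ, hrep⟩ := hl hDel F h6 V a₀ Φ hΦ i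
  exact spectrumIsThetaAtLevel_of_parts (datum413 hDel F V a₀ Φ i) (rightRep F V) (cohForms (archFactorOf F V)) (cotPart F V (archFactorOf F V) μ ℓ)
    (ha hDel F h6 V a₀ Φ hΦ i μ ℓ hrep) (he hDel F h6 V a₀ Φ hΦ i μ ℓ hrep)

set_option synthInstance.maxHeartbeats 400000 in
set_option maxHeartbeats 8000000 in
/-- **HEAD 1 — the floor binder from the three stub STATEMENTS** (crux-plan shape `U1′ → U2′ → U4 → HdictEType`; Hecke-level rigidity and Def. 4.11 are theorems, the
archimedean factor is the constructed `archFactorOf F V`; no `sorry` in its closure): the generic composition `dictionaryExistence_of_parts` at `P = datum413 …`, `R = rightRep F V`,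
`A = cohForms (archFactorOf F V)`. [cite: Liu2021, proof of Prop. 4.13, l. 2145; Rem. 4.14] [cite: GelbartRogawski1991, Introduction p. 448 L30–33; Thm 5.1.1 p. 465] -/
theorem oscillatorTriple_dictionaryExistence_holds_of (h1 : StubU1RealisationAt) (h2 : StubU2CohFormsSpectrumIsThetaAt) (h4 : StubU4SignRule) : HdictEType :=
  fun hDel F _ h6 _ V a₀ Φ hΦ i =>
    dictionaryExistence_of_parts (datum413 hDel F V a₀ Φ i) (rightRep F V) (cohForms (archFactorOf F V))
      (h1 hDel F h6 V a₀ Φ hΦ i) (h2 hDel F h6 V a₀ Φ hΦ i) (omegaIrreducibleOrZero_datum413 hDel F h6 V a₀ Φ hΦ i) (h4 hDel F h6 V a₀ Φ hΦ i)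

/-- **HEAD 1′ — the floor binder `hdictE` from the FIVE stub statements of this sub-line** (`U1′ → U2ℓ → U2a → E2E2b → U4 → HdictEType`). [cite: Liu2021, proof of Prop. 4.13, l. 2145; Rem. 4.14]
[cite: GelbartRogawski1991, Introduction p. 448 L30–33; Thm 5.1.1 p. 465] -/
theorem oscillatorTriple_dictionaryExistence_holds_of_split (h1 : StubU1RealisationAt) (hl : StubU2lL2Realisation) (ha : StubU2aSpectralProjection)
    (he : StubE2E2bCotPartSpectrumIsTheta) (h4 : StubU4SignRule) : HdictEType :=
  oscillatorTriple_dictionaryExistence_holds_of h1 (stubU2_of hl ha he) h4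

set_option synthInstance.maxHeartbeats 400000 in
set_option maxHeartbeats 8000000 in
/-- **HEAD 3 — the crux decl `HCCMUnconditional.H413` BY NAME from the five stub statements and the other two floor rows (P3's `hJ3a`, P4's `hocc`)**, via ★
`Hyp413Closing.H413_of_three_facts_flat`.  This is the theorem the line audit of crux item stmt-HodgeConjecture-24833 reads. [cite: Liu2021, Prop. 4.13 and proof l. 2121–2146; Rem. 4.14]
[cite: GelbartRogawski1991, Introduction p. 448; Thm 5.1.1] [cite: Rogawski1990, Thm. 13.3.1] -/
theorem H413_of_split (h1 : StubU1RealisationAt) (hl : StubU2lL2Realisation) (ha : StubU2aSpectralProjection) (he : StubE2E2bCotPartSpectrumIsTheta)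
    (h4 : StubU4SignRule) (hJ3a : HJ3aType) (hocc : HoccType) : Summit.HodgeConjecture.HodgeConjecture.Theses.HCCMUnconditional.H413 :=
  Summit.HodgeConjecture.CorCM.Hyp413Closing.H413_of_three_facts_flat (oscillatorTriple_dictionaryExistence_holds_of_split h1 hl ha he h4) hJ3a hocc

end Summit.HodgeConjecture.HodgeConjecture.Cruxes.H413.SpectrumInterfaces
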